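import Literature.AlgebraicGeometry.AbelianSchemes.SymplecticLiftChangeLevel
import Mathlib.CategoryTheory.CofilteredSystem
import HarnessLib

/-!
# Powering a finite-level symplectic datum down the torsion tower, and König's lemma on a chain
# ([Lan2013PELCompactifications, §1.3.6 Lemma 1.3.6.5]; cell hodgecm-mathlib, F-DAG (h9-S) piece (S1), file 1 of 2)

Layer `Literature/AlgebraicGeometry/AbelianSchemes`, namespace `Literature.AlgebraicGeometry.AbelianSchemes.AbelianSchemeOver`.
THEOREMS ONLY (no definition, no named fact, no instance, no `sorry`).

[Lan2013PELCompactifications, Lemma 1.3.6.5 (p. 81)] reads a symplectic lift `α̂ : L ⊗ Ẑ ⥲ T A_s̄` through its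
reductions `α_{m,s̄} : L/mL ⥲ A[m]_s̄`; in the tree's carrier ★ `AbelianSchemeSymplecticLevel` these are homomorphisms
`(ℤ/M)^{2g} →* A_s[M](Ω)` and «reduction from level `dM` to level `M`» is `x ↦ L(x̃)^d` for any lift `x̃`.  ★
`SymplecticLiftChangeLevel` performs this power-down for a whole TOWER `Λ`; here the same bookkeeping is done for ONE bare
homomorphism `L : (ℤ/dM)^ι →* A[dM](K)` over an abelian variety `A/K` (no tower, no level structure), which is what the
König argument of file 2 (★-to-be `SymplecticLiftOfFiniteLevels`: «a symplectic lift exists iff a symplectic similitude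
lifting `φ(s)` exists at every single level») manipulates.

* §1 `pow_apply_eq_pow_apply_of_cast_eq` (two lifts agree after `^d`), `exists_monoidHom_powDown` (the powered-down
  homomorphism `L'(x) = L(x̃)^d` exists), `bijective_of_powDown`, `weilPairingLevel_powDown` (bijectivity and the
  similitude clause `ē^Θ_M(L'x, L'y) = (ζ^d)^{E_δ(x,y)}` come down, via ★ `weilPairingLevel_level_mul`,
  [Lang1983AbelianVarieties] VII §2 Prop. 5);
* §2 `exists_seq_of_forall_exists_chain` — KÖNIG's lemma on a chain (finite types `X j`, relations between consecutive
  indices, compatible strings of every finite length ⇒ an infinite compatible sequence), from Mathlib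
  `nonempty_sections_of_finite_inverse_system`; and the exponent identity `factorial_pred_mul_mul_eq` of the spreading step.

Cell hodgecm-mathlib (D-0151), F-DAG second wave (h9) (price sheet `B-provers/B-p03/g16/F-DAG-PRICE` §5b (9)), symplectic
half (S1); B-plan1 (g15) 02:48:26Z.  Count-neutral capital; HC_CM is proved only modulo the 7 printed citations until rung
0 closes — nothing here is about HC.

## References
* [Lan2013PELCompactifications] K.-W. Lan, *Arithmetic compactifications of PEL-type Shimura varieties*, LMS Monographs
  36 (2013), §1.3.6 Def. 1.3.6.2 (p. 80), Lemma 1.3.6.5 (p. 81), Lemma 1.3.6.6 (pp. 81–82).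
* [Lang1983AbelianVarieties] S. Lang, *Abelian Varieties* (1983), Ch. VII §2 Prop. 5.
* D. Kőnig, *Über eine Schlussweise aus dem Endlichen ins Unendliche*, Acta Sci. Math. (Szeged) 3 (1927) 121–130.
* Tree: ★ `AbelianSchemeSymplecticLevel` (`typeFormMod`), ★ `SymplecticLiftChangeLevel` (`castHom_typeFormMod`,
  `typeFormMod_nsmul_right`), ★ `Motives.AbelianVarietyWeilPairingLevel` (`weilPairingLevel_level_mul`, `torsionPointsPow`,
  `torsionPointsOfDvd`).
-/

universe u

open CategoryTheory CategoryTheory.Limits AlgebraicGeometry MonoidalCategory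

noncomputable section

namespace Literature.AlgebraicGeometry.AbelianSchemes

open Literature.AlgebraicGeometry.Motives Literature.AlgebraicGeometry.AbelianVarieties

open scoped MonObj

namespace AbelianSchemeOver

/-! ### §1 Powering down a bare level datum `(ℤ/dM)^ι →* A[dM](K)` to level `M` -/

section PowDown

variable {K : Type u} [Field K] (B : AbelianVariety K) {I : Type}

/-- **Two lifts to `(ℤ/M')^ι` (`M' = dM`) of the same vector of `(ℤ/M)^ι` have the same image under `[d] ∘ L`** for ANY
homomorphism `L : (ℤ/M')^ι →* A[M'](K)`: their difference is `M • c` and `L(M • c)^d = L(c)^{dM} = 1` (the `Λ`-free form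
of ★ `SymplecticLift.pow_lift_eq_of_cast_eq`). [cite: Lan2013PELCompactifications, §1.3.6 Lemma 1.3.6.5 (p. 81)] -/
theorem pow_apply_eq_pow_apply_of_cast_eq {d M M' : ℕ} (hd : d * M = M') (hM : M ≠ 0)
    (L : Multiplicative (I → ZMod M') →* B.torsionPoints K (M' : ℤ)) (u v : I → ZMod M')
    (huv : ∀ k, (ZMod.cast (u k) : ZMod M) = ZMod.cast (v k)) :
    ((L (Multiplicative.ofAdd u)) : B.Points K) ^ d = ((L (Multiplicative.ofAdd v)) : B.Points K) ^ d := by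
  subst hd
  by_cases hd0 : d = 0
  · subst hd0; rw [pow_zero, pow_zero]
  haveI : NeZero (d * M) := ⟨Nat.mul_ne_zero hd0 hM⟩
  haveI : NeZero M := ⟨hM⟩
  have hdiv : ∀ k, M ∣ (u k - v k).val := fun k => by
    have h0 : (ZMod.cast (u k - v k) : ZMod M) = 0 := by
      rw [ZMod.cast_sub (dvd_mul_left M d), huv k, sub_self]
    rw [ZMod.cast_eq_val, ZMod.natCast_eq_zero_iff] at h0
    exact h0
  have huvc : u = v + M • fun k => (((u k - v k).val / M : ℕ) : ZMod (d * M)) := by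
    funext k
    have hk : u k - v k = (M : ZMod (d * M)) * (((u k - v k).val / M : ℕ) : ZMod (d * M)) := by
      rw [← Nat.cast_mul, Nat.mul_div_cancel' (hdiv k), ZMod.natCast_zmod_val]
    rw [Pi.add_apply, Pi.smul_apply, nsmul_eq_mul, ← hk, add_sub_cancel]
  rw [huvc, ofAdd_add, ofAdd_nsmul, map_mul, map_pow, Subgroup.coe_mul, Subgroup.coe_pow, mul_pow, ← pow_mul,
    Nat.mul_comm M d, AbelianVariety.coe_torsionPoints_pow_eq_one, mul_one]

/-- **The powered-down homomorphism exists**: for `L : (ℤ/M')^ι →* A[M'](K)` there is `L' : (ℤ/M)^ι →* A[M](K)` with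
`L'(x) = L(x̃)^d` for EVERY lift `x̃` of `x` whenever `dM = M'`, `M ≠ 0` («`lift'_M := [d] ∘ lift_{dM} ∘ lift`», the
`Λ`-free ★ `SymplecticLift.liftPow`; for junk parameters `L'` is unconstrained).
[cite: Lan2013PELCompactifications, §1.3.6 Lemma 1.3.6.5 (p. 81)] -/
theorem exists_monoidHom_powDown (d M M' : ℕ) (L : Multiplicative (I → ZMod M') →* B.torsionPoints K (M' : ℤ)) :
    ∃ L' : Multiplicative (I → ZMod M) →* B.torsionPoints K (M : ℤ),
      M ≠ 0 → d * M = M' → ∀ (x : I → ZMod M) (u : I → ZMod M'), (∀ k, (ZMod.cast (u k) : ZMod M) = x k) →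
        ((L' (Multiplicative.ofAdd x)) : B.Points K) = ((L (Multiplicative.ofAdd u)) : B.Points K) ^ d := by
  by_cases h : M ≠ 0 ∧ d * M = M'
  swap
  · exact ⟨1, fun hM hd => (h ⟨hM, hd⟩).elim⟩
  obtain ⟨hM, hd⟩ := h
  subst hd
  haveI : NeZero M := ⟨hM⟩
  have hmem : ∀ u : I → ZMod (d * M), ((L (Multiplicative.ofAdd u) : B.Points K)) ^ d ∈ B.torsionPoints K (M : ℤ) := by
    intro u
    rw [AbelianVariety.mem_torsionPoints_iff, zpow_natCast, ← pow_mul, AbelianVariety.coe_torsionPoints_pow_eq_one]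
  let f : Multiplicative (I → ZMod M) → B.torsionPoints K (M : ℤ) := fun x =>
    ⟨((L (Multiplicative.ofAdd fun k => ((Multiplicative.toAdd x k).val : ZMod (d * M))) : B.Points K)) ^ d, hmem _⟩
  have hf : ∀ x : I → ZMod M, ((f (Multiplicative.ofAdd x) : B.torsionPoints K (M : ℤ)) : B.Points K) =
      ((L (Multiplicative.ofAdd fun k => ((x k).val : ZMod (d * M)))) : B.Points K) ^ d := fun _ => rfl
  refine ⟨MonoidHom.mk' f fun x y => ?_, fun _ _ x u hu => ?_⟩
  · apply Subtype.ext
    rw [Subgroup.coe_mul, ← ofAdd_toAdd x, ← ofAdd_toAdd y, ← ofAdd_add, hf, hf, hf, ← mul_pow, ← Subgroup.coe_mul,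
      ← map_mul, ← ofAdd_add]
    refine pow_apply_eq_pow_apply_of_cast_eq B rfl hM L _ _ fun k => ?_
    simp only [Pi.add_apply, ZMod.cast_add (dvd_mul_left M d), ZMod.cast_natCast (dvd_mul_left M d),
      ZMod.natCast_zmod_val]
  · rw [MonoidHom.mk'_apply, hf]
    refine pow_apply_eq_pow_apply_of_cast_eq B rfl hM L _ _ fun k => ?_
    rw [ZMod.cast_natCast (dvd_mul_left M d), ZMod.natCast_zmod_val, hu]

variable {B}

/-- **Powering down preserves bijectivity**: if `L : (ℤ/dM)^ι →* A[dM](K)` is bijective and `L'(x) = L(x̃)^d`, then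
`L' : (ℤ/M)^ι →* A[M](K)` is bijective — injective because `d • x̃ = d • ỹ` in `(ℤ/dM)^ι` forces `x = y`, surjective because
an `M`-torsion point is `L(w)` with `M • w = 0`, i.e. `w = d • x̃` (no divisibility of POINTS is used; the `Λ`-free ★
`SymplecticLift.changeLevel.lift_bijective`). [cite: Lan2013PELCompactifications, §1.3.6 Lemma 1.3.6.5 (p. 81)] -/
theorem bijective_of_powDown {d M M' : ℕ} (hd : d * M = M') (hd0 : d ≠ 0) (hM : M ≠ 0)
    {L : Multiplicative (I → ZMod M') →* B.torsionPoints K (M' : ℤ)} (hL : Function.Bijective L)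
    {L' : Multiplicative (I → ZMod M) →* B.torsionPoints K (M : ℤ)}
    (hL' : ∀ (x : I → ZMod M) (u : I → ZMod M'), (∀ k, (ZMod.cast (u k) : ZMod M) = x k) →
      ((L' (Multiplicative.ofAdd x)) : B.Points K) = ((L (Multiplicative.ofAdd u)) : B.Points K) ^ d) :
    Function.Bijective L' := by
  subst hd
  haveI : NeZero M := ⟨hM⟩
  haveI : NeZero (d * M) := ⟨Nat.mul_ne_zero hd0 hM⟩
  -- `L'(x) = L(d • x̂)` with the canonical lift `x̂ k := (x k).val`
  have key : ∀ x : I → ZMod M, ((L' (Multiplicative.ofAdd x)) : B.Points K) =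
      L (Multiplicative.ofAdd (d • fun k => ((x k).val : ZMod (d * M)))) := by
    intro x
    rw [hL' x (fun k => ((x k).val : ZMod (d * M))) fun k => by
        rw [ZMod.cast_natCast (dvd_mul_left M d), ZMod.natCast_zmod_val],
      ofAdd_nsmul, map_pow, Subgroup.coe_pow]
  have hlt : ∀ c : ZMod M, d * c.val < d * M := fun c =>
    Nat.mul_lt_mul_of_pos_left (ZMod.val_lt c) (Nat.pos_of_ne_zero hd0)
  constructor
  · intro x y hxy
    have h : L (Multiplicative.ofAdd (d • fun k => (((Multiplicative.toAdd x) k).val : ZMod (d * M)))) =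
        L (Multiplicative.ofAdd (d • fun k => (((Multiplicative.toAdd y) k).val : ZMod (d * M)))) := by
      apply Subtype.ext
      rw [← key, ← key, ofAdd_toAdd, ofAdd_toAdd, hxy]
    have h' := congrArg Multiplicative.toAdd (hL.1 h)
    rw [toAdd_ofAdd, toAdd_ofAdd] at h'
    apply Multiplicative.toAdd.injective
    funext k
    have hk := congrArg ZMod.val (congrFun h' k)
    rw [Pi.smul_apply, Pi.smul_apply, nsmul_eq_mul, nsmul_eq_mul, ← Nat.cast_mul, ← Nat.cast_mul,
      ZMod.val_natCast, ZMod.val_natCast, Nat.mod_eq_of_lt (hlt _), Nat.mod_eq_of_lt (hlt _)] at hk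
    exact ZMod.val_injective M (Nat.eq_of_mul_eq_mul_left (Nat.pos_of_ne_zero hd0) hk)
  · intro P
    have hPdM : ((P : B.Points K)) ∈ B.torsionPoints K ((d * M : ℕ) : ℤ) := by
      rw [AbelianVariety.mem_torsionPoints_iff, zpow_natCast, pow_mul', AbelianVariety.coe_torsionPoints_pow_eq_one,
        one_pow]
    obtain ⟨w', hw'⟩ := hL.2 ⟨_, hPdM⟩
    set w : I → ZMod (d * M) := Multiplicative.toAdd w' with hwdef
    have hw'' : Multiplicative.ofAdd w = w' := ofAdd_toAdd w'
    have hMw : M • w = 0 := by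
      have h1 : L (Multiplicative.ofAdd (M • w)) = 1 := by
        apply Subtype.ext
        rw [ofAdd_nsmul, map_pow, Subgroup.coe_pow, hw'', hw', OneMemClass.coe_one]
        exact AbelianVariety.coe_torsionPoints_pow_eq_one P
      have h2 := congrArg Multiplicative.toAdd (hL.1 (h1.trans (map_one _).symm))
      rwa [toAdd_ofAdd, toAdd_one] at h2
    have hdvd : ∀ k, d ∣ (w k).val := fun k => by
      have hk : ((M * (w k).val : ℕ) : ZMod (d * M)) = 0 := by
        have h := congrFun hMw k
        rw [Pi.smul_apply, Pi.zero_apply, nsmul_eq_mul] at h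
        rw [Nat.cast_mul, ZMod.natCast_zmod_val]
        exact h
      rw [ZMod.natCast_eq_zero_iff] at hk
      have hk' : M * d ∣ M * (w k).val := by rw [Nat.mul_comm M d]; exact hk
      exact Nat.dvd_of_mul_dvd_mul_left (Nat.pos_of_ne_zero hM) hk'
    set a : I → ZMod M := fun k => (((w k).val / d : ℕ) : ZMod M) with hadef
    refine ⟨Multiplicative.ofAdd a, Subtype.ext ?_⟩
    rw [key]
    have hvec : (d • fun k => ((a k).val : ZMod (d * M))) = w := by
      funext k
      rw [Pi.smul_apply, nsmul_eq_mul, hadef]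
      dsimp only
      rw [ZMod.val_natCast, Nat.mod_eq_of_lt (Nat.div_lt_of_lt_mul ?_), ← Nat.cast_mul,
        Nat.mul_div_cancel' (hdvd k), ZMod.natCast_zmod_val]
      exact ZMod.val_lt _
    rw [hvec, hw'', hw']

/-- **Powering down a symplectic similitude gives a symplectic similitude**: if `ē^Θ_{dM}(L x, L y) = ζ^{E_δ(x,y)}` at level
`dM` for a primitive `dM`-th root `ζ`, and `L'(x) = L(x̃)^d`, then `ē^Θ_M(L' x, L' y) = (ζ^d)^{E_δ(x,y)}` at level `M` — ★
`weilPairingLevel_level_mul` («`ē_{dM}(P, Q) = ē_M(P^d, Q)`», [Lang1983AbelianVarieties] VII §2 Prop. 5) and the bookkeeping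
`E_δ(x̃, d • ỹ) ≡ d · E_δ(x, y) (mod dM)` (the `Λ`-free ★ `SymplecticLift.changeLevel.pairing`).
[cite: Lang1983AbelianVarieties, Ch. VII §2 Prop. 5] [cite: Lan2013PELCompactifications, §1.3.6 Lemma 1.3.6.5 (p. 81)] -/
theorem weilPairingLevel_powDown {g : ℕ} (δ : Fin g → ℕ) {d M M' : ℕ} (hd : d * M = M') (hd0 : d ≠ 0) (hM : M ≠ 0)
    (Θ : CartierDivisor B.X.left) {ζ : K} (hζ : IsPrimitiveRoot ζ M')
    {L : Multiplicative (Fin g ⊕ Fin g → ZMod M') →* B.torsionPoints K (M' : ℤ)}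
    (hpair : ∀ (hMΩ : ((M' : ℕ) : K) ≠ 0) (x y : Fin g ⊕ Fin g → ZMod M'),
      haveI := AbelianVariety.isDominant_toSchemeHom_zsmul_of_ne_zero B hMΩ
      B.weilPairingLevel Θ (L (Multiplicative.ofAdd x)) (L (Multiplicative.ofAdd y)) = ζ ^ (typeFormMod δ M' x y).val)
    {L' : Multiplicative (Fin g ⊕ Fin g → ZMod M) →* B.torsionPoints K (M : ℤ)}
    (hL' : ∀ (x : Fin g ⊕ Fin g → ZMod M) (u : Fin g ⊕ Fin g → ZMod M'), (∀ k, (ZMod.cast (u k) : ZMod M) = x k) →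
      ((L' (Multiplicative.ofAdd x)) : B.Points K) = ((L (Multiplicative.ofAdd u)) : B.Points K) ^ d)
    (hMΩ : ((M : ℕ) : K) ≠ 0) (x y : Fin g ⊕ Fin g → ZMod M) :
    haveI := AbelianVariety.isDominant_toSchemeHom_zsmul_of_ne_zero B hMΩ
    B.weilPairingLevel Θ (L' (Multiplicative.ofAdd x)) (L' (Multiplicative.ofAdd y)) =
      (ζ ^ d) ^ (typeFormMod δ M x y).val := by
  subst hd
  haveI : NeZero M := ⟨hM⟩
  haveI : NeZero (d * M) := ⟨Nat.mul_ne_zero hd0 hM⟩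
  have hdMΩ : ((d * M : ℕ) : K) ≠ 0 := (hζ.neZero' (R := K)).ne
  have hdΩ : (d : K) ≠ 0 := by
    intro h; apply hdMΩ; rw [Nat.cast_mul, h, zero_mul]
  letI := AbelianVariety.isDominant_toSchemeHom_zsmul_of_ne_zero B hMΩ
  letI := AbelianVariety.isDominant_toSchemeHom_zsmul_of_ne_zero B hdMΩ
  letI := AbelianVariety.isDominant_toSchemeHom_zsmul_of_ne_zero B hdΩ
  -- the canonical lifts and `L'` through `torsionPointsPow`
  have ex : L' (Multiplicative.ofAdd x) =
      B.torsionPointsPow d (L (Multiplicative.ofAdd fun k => ((x k).val : ZMod (d * M)))) := by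
    apply Subtype.ext
    rw [AbelianVariety.coe_torsionPointsPow]
    exact hL' x _ fun k => by rw [ZMod.cast_natCast (dvd_mul_left M d), ZMod.natCast_zmod_val]
  have ey : L' (Multiplicative.ofAdd y) =
      B.torsionPointsPow d (L (Multiplicative.ofAdd fun k => ((y k).val : ZMod (d * M)))) := by
    apply Subtype.ext
    rw [AbelianVariety.coe_torsionPointsPow]
    exact hL' y _ fun k => by rw [ZMod.cast_natCast (dvd_mul_left M d), ZMod.natCast_zmod_val]
  rw [ex, ey, ← AbelianVariety.weilPairingLevel_level_mul]
  have hq : B.torsionPointsOfDvd d (B.torsionPointsPow d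
        (L (Multiplicative.ofAdd fun k => ((y k).val : ZMod (d * M))))) =
      L (Multiplicative.ofAdd (d • fun k => ((y k).val : ZMod (d * M)))) := by
    apply Subtype.ext
    rw [AbelianVariety.coe_torsionPointsOfDvd, AbelianVariety.coe_torsionPointsPow, ofAdd_nsmul, map_pow,
      Subgroup.coe_pow]
  rw [hq]
  have hp := hpair hdMΩ (fun k => ((x k).val : ZMod (d * M))) (d • fun k => ((y k).val : ZMod (d * M)))
  rw [hp, ← pow_mul]
  have hζ1 : ζ ^ (d * M) = 1 := hζ.pow_eq_one
  set a := typeFormMod δ (d * M) (fun k => ((x k).val : ZMod (d * M))) fun k => ((y k).val : ZMod (d * M)) with ha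
  have hred : (ZMod.castHom (dvd_mul_left M d) (ZMod M)) a = typeFormMod δ M x y := by
    rw [ha, castHom_typeFormMod]
    congr 1 <;> funext k <;>
      rw [ZMod.castHom_apply, ZMod.cast_natCast (dvd_mul_left M d), ZMod.natCast_zmod_val]
  have hmodM : a.val ≡ (typeFormMod δ M x y).val [MOD M] := by
    rw [← ZMod.natCast_eq_natCast_iff, ZMod.natCast_zmod_val, ← hred, ZMod.castHom_apply, ZMod.cast_eq_val]
  have hmod : (typeFormMod δ (d * M) (fun k => ((x k).val : ZMod (d * M)))
        (d • fun k => ((y k).val : ZMod (d * M)))).val ≡ d * (typeFormMod δ M x y).val [MOD d * M] := by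
    rw [typeFormMod_nsmul_right, ← ha, nsmul_eq_mul, ZMod.val_mul, ZMod.val_natCast]
    exact ((Nat.mod_modEq _ _).trans ((Nat.mod_modEq d (d * M)).mul_right a.val)).trans (hmodM.mul_left' d)
  rw [pow_eq_pow_mod _ hζ1,
    show (typeFormMod δ (d * M) (fun k => ((x k).val : ZMod (d * M))) (d • fun k => ((y k).val : ZMod (d * M)))).val %
        (d * M) = d * (typeFormMod δ M x y).val % (d * M) from hmod,
    ← pow_eq_pow_mod _ hζ1]

end PowDown

/-! ### §2 König's lemma on a chain -/

/-- **König's lemma on a chain**: if `X j` are finite types and `C j ⊆ X j × X (j+1)` relations such that for every `n`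
there is a finite compatible string `t₀, …, tₙ` (`C j (t j) (t (j+1))` for `j < n`), then there is an infinite compatible
sequence.  (The truncated strings form an inverse system, indexed by `ℕ`, of finite non-empty sets — Mathlib
`nonempty_sections_of_finite_inverse_system`.) [cite: Lan2013PELCompactifications, §1.3.6 Lemma 1.3.6.6 (pp. 81–82)] -/
theorem exists_seq_of_forall_exists_chain {X : ℕ → Type u} [∀ j, Finite (X j)] (C : ∀ j, X j → X (j + 1) → Prop)
    (h : ∀ n : ℕ, ∃ t : (j : Fin (n + 1)) → X j,
      ∀ (j : ℕ) (hj : j + 1 < n + 1), C j (t ⟨j, Nat.lt_of_succ_lt hj⟩) (t ⟨j + 1, hj⟩)) :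
    ∃ D : ∀ j, X j, ∀ j, C j (D j) (D (j + 1)) := by
  classical
  -- the inverse system of truncated compatible strings
  let obj : ℕ → Type u := fun n =>
    {t : (j : Fin (n + 1)) → X j // ∀ (j : ℕ) (hj : j + 1 < n + 1), C j (t ⟨j, Nat.lt_of_succ_lt hj⟩) (t ⟨j + 1, hj⟩)}
  let res : ∀ {n m : ℕ}, n ≤ m → obj m → obj n := fun hnm t =>
    ⟨fun j => t.1 (Fin.castLE (Nat.succ_le_succ hnm) j), fun j hj =>
      t.2 j (Nat.lt_of_lt_of_le hj (Nat.succ_le_succ hnm))⟩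
  let F : ℕᵒᵖ ⥤ Type u :=
    { obj := fun n => obj n.unop
      map := fun f => TypeCat.ofHom fun t => res (leOfHom f.unop) t }
  haveI : ∀ n : ℕᵒᵖ, Finite (F.obj n) := fun n => show Finite (obj n.unop) from inferInstance
  haveI : ∀ n : ℕᵒᵖ, Nonempty (F.obj n) := fun n => by
    obtain ⟨t, ht⟩ := h n.unop
    exact show Nonempty (obj n.unop) from ⟨⟨t, ht⟩⟩
  obtain ⟨sec, hsec⟩ := nonempty_sections_of_finite_inverse_system F
  let D : ∀ j : ℕ, obj j := fun j => sec (Opposite.op j)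
  -- compatibility at `j` is read in the string of length `j + 2`, whose restriction is the string of length `j + 1`
  have hres : ∀ j : ℕ, res (Nat.le_succ j) (D (j + 1)) = D j := fun j =>
    hsec ((homOfLE (Nat.le_succ j)).op)
  refine ⟨fun j => (D j).1 (Fin.last j), fun j => ?_⟩
  show C j ((D j).1 (Fin.last j)) ((D (j + 1)).1 (Fin.last (j + 1)))
  rw [← hres j]
  exact (D (j + 1)).2 j (by omega)

/-- Exponent bookkeeping of the spreading step: `(kM-1)!·N·k = ((kM)!/M!)·((M-1)!·N)` (both are `(kM)!·N/M`).
[cite: Lan2013PELCompactifications, §1.3.6 Lemma 1.3.6.5 (p. 81)] -/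
theorem factorial_pred_mul_mul_eq {N M k : ℕ} (hM : M ≠ 0) (hk : k ≠ 0) :
    (k * M - 1).factorial * N * k = (k * M).factorial / M.factorial * ((M - 1).factorial * N) := by
  have h1 : (k * M - 1).factorial * N * k * M = (k * M).factorial * N := by
    rw [show (k * M - 1).factorial * N * k * M = k * M * (k * M - 1).factorial * N by ring,
      Nat.mul_factorial_pred (Nat.mul_ne_zero hk hM)]
  have h2 : (k * M).factorial / M.factorial * ((M - 1).factorial * N) * M = (k * M).factorial * N := by
    rw [show (k * M).factorial / M.factorial * ((M - 1).factorial * N) * M =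
        (k * M).factorial / M.factorial * (M * (M - 1).factorial) * N by ring, Nat.mul_factorial_pred hM,
      Nat.div_mul_cancel (Nat.factorial_dvd_factorial (Nat.le_mul_of_pos_left M (Nat.pos_of_ne_zero hk)))]
  exact Nat.eq_of_mul_eq_mul_right (Nat.pos_of_ne_zero hM) (h1.trans h2.symm)

end AbelianSchemeOver

end Literature.AlgebraicGeometry.AbelianSchemes

end
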